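import Literature.MathematicalPhysics.QuantumLattice.GrassmannTreeExpansionSpectators
import Literature.Probability.LatticeModels.UrsellMultilinear
import HarnessLib

/-!
# Truncated expectations of kernel-weighted (extended) vertices: the multilinear expansion

Topic `Literature/MathematicalPhysics/QuantumLattice`; a companion of `GrassmannTruncatedSpectators.lean`
(even-part-valued truncated expectations `evenTruncated R e A u y W` of a family of even elements, the
fields outside the block being spectators) on the way to the single-scale bound for the effective
potentials of a multiscale expansion (Benfatto–Giuliani–Mastropietro 2006, §2.3–2.4, (2.31), (2.66)–(2.77);
Gawȩdzki–Kupiainen 1985; Gentile–Mastropietro 2001, §4).  Below the first scale a vertex of the tree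
expansion is EXTENDED: the cluster `v` carries the even element
`y v = Σ_{x} K v x • z v x`, a sum over the positions `x τ ∈ Λ` of its SLOTS `τ` (`cS τ = v`) of a
scalar kernel `K v x` times an even monomial `z v x` (both depending on the positions of the slots of `v`
only).  By multilinearity of the truncated expectations,

`𝓔ᵀ(y v : v) = Σ_{x : S → Λ} (∏_v K v x) • 𝓔ᵀ(z v x : v)`   (`evenTruncated_kernelVertices_eq_sum`),

the sum running over the positions of ALL slots at once.  The right-hand side is what the tree
expansion (`GrassmannTreeExpansionSpectators.evenTruncated_evenCluster_eq_treeSum`) and the positional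
estimate for extended vertices (`FermionicTreeExpansionKernelDecay.lean`) control.

* `evenTruncated_eq_sum_smul_update` — **linearity in one argument**: if `y a = Σ_k w_k • y_k` then
  `𝓔ᵀ(y; W) = Σ_k w_k • 𝓔ᵀ(y[a ↦ y_k]; W)` for `W ∋ a` (from the abstract
  `ursellOf_eq_sum_mul_of_linear` of `UrsellMultilinear.lean`);
* `sum_filter_insert_eq_sum_sum_unpinned` — splitting a sum over slot positions frozen outside
  `insert a Q` into the positions of the slots of `Q` and of `a` (recombined by addition);
* **`evenTruncated_kernelVertices_eq_sum`** — the multilinear expansion above (induction on the set of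
  expanded clusters).

Everything is proved; no named fact.

## Sources

G. Benfatto, A. Giuliani, V. Mastropietro, Ann. Henri Poincaré 7 (2006) 809–898, §2.3 (2.31), §2.4
(2.66)–(2.77) (`BenfattoGiulianiMastropietro2006`); V. Mastropietro, *Non-Perturbative Renormalization*
(2008), §2.3–2.4 (`Mastropietro2008`); D. Ruelle, *Statistical Mechanics* (1969), §4.4.2 (`Ruelle1969`).
-/

noncomputable section

namespace Literature.MathematicalPhysics.QuantumLattice

open GrassmannAlgebra Finset Literature.Probability.LatticeModels

section Block

variable (R : Type*) [CommRing R] [Algebra ℚ R] {ι : Type*} [LinearOrder ι] [Fintype ι]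
  {J : Type*} [LinearOrder J] [Fintype J]
variable (e : ι ⊕ₗ ι ↪o J) (A : Matrix ι ι R) (u : R)
variable {α : Type*} [DecidableEq α]

/-! ### Linearity of the truncated expectation in one argument -/

/-- The moment of a family updated at `a` on a set not containing `a` is unchanged. [folklore] -/
theorem evenMoment_update_of_not_mem (y : α → evenPart R J) (a : α) (t : evenPart R J)
    {P : Finset α} (ha : a ∉ P) :
    evenMoment R e A u (Function.update y a t) P = evenMoment R e A u y P := by
  unfold evenMoment
  congr 1
  exact prod_congr rfl fun i hi => Function.update_of_ne (ne_of_mem_of_not_mem hi ha) _ _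

/-- The moment of a family updated at `a ∈ P`: `𝓔(t · ∏_{P ∖ a} y)`. [folklore] -/
theorem evenMoment_update_of_mem (y : α → evenPart R J) (a : α) (t : evenPart R J)
    {P : Finset α} (ha : a ∈ P) :
    evenMoment R e A u (Function.update y a t) P = evenGaussOn R e A u (t * ∏ i ∈ P.erase a, y i) := by
  unfold evenMoment
  rw [← mul_prod_erase P _ ha, Function.update_self]
  congr 2
  exact prod_congr rfl fun i hi => Function.update_of_ne (ne_of_mem_erase hi) _ _

/-- **The truncated expectation is linear in each argument** (Ruelle 1969, §4.4.2; Benfatto–Giuliani–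
Mastropietro 2006, (2.31)): if `y a = Σ_{k ∈ T} w_k • y_k` then, for every `W ∋ a`,
`𝓔ᵀ(y; W) = Σ_{k ∈ T} w_k • 𝓔ᵀ(y[a ↦ y_k]; W)`. [cite: Ruelle1969, §4.4.2] -/
theorem evenTruncated_eq_sum_smul_update {β : Type*} (T : Finset β) (w : β → R) (yk : β → evenPart R J)
    (y : α → evenPart R J) (a : α) (hy : y a = ∑ k ∈ T, w k • yk k) {W : Finset α} (ha : a ∈ W) :
    evenTruncated R e A u y W = ∑ k ∈ T, w k • evenTruncated R e A u (Function.update y a (yk k)) W := by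
  unfold evenTruncated
  have h := ursellOf_eq_sum_mul_of_linear T (fun k => algebraMap R (evenPart R J) (w k))
    (evenMoment R e A u y) (fun k => evenMoment R e A u (Function.update y a (yk k))) a
    (fun k _ P hP => evenMoment_update_of_not_mem R e A u y a (yk k) hP) (fun P hP => ?_) W ha
  · rw [h]
    exact sum_congr rfl fun k _ => (Algebra.smul_def _ _).symm
  · rw [evenMoment, ← mul_prod_erase P _ hP, hy, sum_mul, map_sum]
    refine sum_congr rfl fun k _ => ?_
    rw [evenMoment_update_of_mem R e A u y a (yk k) hP, smul_mul_assoc, map_smul, Algebra.smul_def]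

/-! ### Kernel-weighted vertices: the multilinear expansion over the slot positions -/

variable {S : Type*} [Fintype S] [DecidableEq S] {Λ : Type*} [AddCommGroup Λ] [Fintype Λ] [DecidableEq Λ]

omit [DecidableEq α] in
/-- **Splitting off the slots of one cluster** (unpinned form of
`BattleFederbush.sum_filter_insert_eq_sum_sum`): a sum over the slot positions free on the clusters of
`insert a Q` and frozen at `0` elsewhere is the iterated sum over the positions free on `Q` and the positions
of the slots of `a ∉ Q`, recombined by addition. [folklore] -/
theorem sum_filter_insert_eq_sum_sum_unpinned {M : Type*} [AddCommMonoid M] [DecidableEq α] (cS : S → α)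
    (Q : Finset α) {a : α} (ha : a ∉ Q) (Φ : (S → Λ) → M) :
    ∑ x ∈ univ.filter (fun x : S → Λ => ∀ τ, cS τ ∉ insert a Q → x τ = 0), Φ x =
      ∑ x' ∈ univ.filter (fun x : S → Λ => ∀ τ, cS τ ∉ Q → x τ = 0),
        ∑ y ∈ univ.filter (fun y : S → Λ => ∀ τ, cS τ ≠ a → y τ = 0), Φ (x' + y) := by
  classical
  set rOf : (S → Λ) → (S → Λ) := fun x τ => if cS τ = a then 0 else x τ with hrOf
  set yOf : (S → Λ) → (S → Λ) := fun x τ => if cS τ = a then x τ else 0 with hyOf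
  rw [← sum_product' (univ.filter fun x : S → Λ => ∀ τ, cS τ ∉ Q → x τ = 0)
    (univ.filter fun y : S → Λ => ∀ τ, cS τ ≠ a → y τ = 0) fun x' y => Φ (x' + y)]
  refine sum_nbij' (fun x => (rOf x, yOf x)) (fun p => p.1 + p.2) ?_ ?_ ?_ ?_ ?_
  · intro x hx
    have hx0 := (mem_filter.1 hx).2
    refine mem_product.2 ⟨mem_filter.2 ⟨mem_univ _, fun τ hτ => ?_⟩, mem_filter.2 ⟨mem_univ _, fun τ hτ => ?_⟩⟩
    · by_cases h : cS τ = a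
      · simp [hrOf, h]
      · simp only [hrOf, h, if_false]
        exact hx0 τ (by rw [mem_insert, not_or]; exact ⟨h, hτ⟩)
    · simp [hyOf, hτ]
  · rintro ⟨x', y⟩ hp
    obtain ⟨hx', hy⟩ := mem_product.1 hp
    have hx0 := (mem_filter.1 hx').2
    have hy0 := (mem_filter.1 hy).2
    dsimp only at hx0 hy0 ⊢
    refine mem_filter.2 ⟨mem_univ _, fun τ hτ => ?_⟩
    rw [mem_insert, not_or] at hτ
    rw [Pi.add_apply, hx0 τ hτ.2, hy0 τ hτ.1, add_zero]
  · intro x _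
    funext τ
    by_cases h : cS τ = a <;> simp [hrOf, hyOf, h]
  · rintro ⟨x', y⟩ hp
    obtain ⟨hx', hy⟩ := mem_product.1 hp
    have hx0 := (mem_filter.1 hx').2
    have hy0 := (mem_filter.1 hy).2
    dsimp only at hx0 hy0
    refine Prod.ext ?_ ?_
    · funext τ
      by_cases h : cS τ = a
      · simp only [hrOf, h, if_true]
        exact (hx0 τ (h ▸ ha)).symm
      · simp only [hrOf, h, if_false, Pi.add_apply]
        rw [hy0 τ h, add_zero]
    · funext τ
      by_cases h : cS τ = a
      · simp only [hyOf, h, if_true, Pi.add_apply]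
        rw [hx0 τ (h ▸ ha), zero_add]
      · simp only [hyOf, h, if_false]
        exact (hy0 τ h).symm
  · intro x _
    show Φ x = Φ (rOf x + yOf x)
    congr 1
    funext τ
    by_cases h : cS τ = a <;> simp [hrOf, hyOf, h]

/-- **The multilinear expansion of the truncated expectation of kernel-weighted vertices**
(Benfatto–Giuliani–Mastropietro 2006, (2.31) with (2.66)): the cluster `v` carries
`y v = Σ_{x : positions of the slots of v} K v x • z v x` (the positions of the other slots frozen at `0`;
the scalar kernel `K v` and the even element `z v` depend on the positions of the slots of `v` only); then
`𝓔ᵀ(y v : v ∈ univ) = Σ_{x : S → Λ} (∏_v K v x) • 𝓔ᵀ(z v x : v ∈ univ)`.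
[cite: BenfattoGiulianiMastropietro2006, (2.31)] -/
theorem evenTruncated_kernelVertices_eq_sum [Fintype α] (cS : S → α) (K : α → (S → Λ) → R)
    (z : α → (S → Λ) → evenPart R J)
    (hK : ∀ v x x', (∀ τ, cS τ = v → x τ = x' τ) → K v x = K v x')
    (hz : ∀ v x x', (∀ τ, cS τ = v → x τ = x' τ) → z v x = z v x') :
    evenTruncated R e A u
        (fun v => ∑ x ∈ univ.filter (fun x : S → Λ => ∀ τ, cS τ ≠ v → x τ = 0), K v x • z v x) univ =
      ∑ x : S → Λ, (∏ v, K v x) • evenTruncated R e A u (fun v => z v x) univ := by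
  classical
  set y : α → evenPart R J := fun v =>
    ∑ x ∈ univ.filter (fun x : S → Λ => ∀ τ, cS τ ≠ v → x τ = 0), K v x • z v x with hydef
  -- induction on the set `Q` of expanded clusters, the others carrying arbitrary even elements
  have key : ∀ (Q : Finset α) (rest : α → evenPart R J),
      evenTruncated R e A u (fun v => if v ∈ Q then y v else rest v) univ =
        ∑ x ∈ univ.filter (fun x : S → Λ => ∀ τ, cS τ ∉ Q → x τ = 0),
          (∏ v ∈ Q, K v x) • evenTruncated R e A u (fun v => if v ∈ Q then z v x else rest v) univ := by
    intro Q
    induction Q using Finset.induction_on with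
    | empty =>
      intro rest
      have hfilter : (univ.filter fun x : S → Λ => ∀ τ, cS τ ∉ (∅ : Finset α) → x τ = 0) = {0} := by
        ext x
        simp only [mem_filter, mem_univ, true_and, Finset.notMem_empty, not_false_eq_true, forall_const,
          mem_singleton]
        exact ⟨fun h => funext h, fun h τ => by rw [h]; rfl⟩
      rw [hfilter, sum_singleton, prod_empty, one_smul]
      simp
    | insert a Q haQ ih =>
      intro rest
      -- the family with `a` not yet expanded
      have hfam : (fun v => if v ∈ insert a Q then y v else rest v) =
          fun v => if v ∈ Q then y v else Function.update rest a (y a) v := by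
        funext v
        by_cases hva : v = a
        · subst hva
          simp [haQ]
        · by_cases hvQ : v ∈ Q
          · simp [hvQ]
          · simp [hvQ, hva]
      rw [hfam, ih (Function.update rest a (y a)), sum_filter_insert_eq_sum_sum_unpinned cS Q haQ]
      refine sum_congr rfl fun x' hx' => ?_
      have hx0 := (mem_filter.1 hx').2
      -- expand the argument `a`
      have hya : (fun v => if v ∈ Q then z v x' else Function.update rest a (y a) v) a =
          ∑ yv ∈ univ.filter (fun yv : S → Λ => ∀ τ, cS τ ≠ a → yv τ = 0), K a yv • z a yv := by
        simp only [haQ, if_false, Function.update_self, hydef]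
      rw [evenTruncated_eq_sum_smul_update R e A u _ (fun yv => K a yv) (fun yv => z a yv) _ a hya
        (mem_univ a), smul_sum]
      refine sum_congr rfl fun yv hyv => ?_
      have hyv0 := (mem_filter.1 hyv).2
      -- agreement of `x' + yv` with `x'` off the slots of `a` and with `yv` on them
      have hoff : ∀ τ, cS τ ≠ a → (x' + yv) τ = x' τ := fun τ hτ => by
        rw [Pi.add_apply, hyv0 τ hτ, add_zero]
      have hon : ∀ τ, cS τ = a → (x' + yv) τ = yv τ := fun τ hτ => by
        rw [Pi.add_apply, hx0 τ (hτ ▸ haQ), zero_add]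
      have hKQ : ∏ v ∈ Q, K v (x' + yv) = ∏ v ∈ Q, K v x' := by
        refine prod_congr rfl fun v hv => hK v _ _ fun τ hτ => hoff τ ?_
        rintro rfl; exact haQ (hτ ▸ hv)
      have hKa : K a (x' + yv) = K a yv := hK a _ _ fun τ hτ => hon τ hτ
      have hupd : Function.update (fun v => if v ∈ Q then z v x' else Function.update rest a (y a) v) a (z a yv) =
          fun v => if v ∈ insert a Q then z v (x' + yv) else rest v := by
        funext v
        by_cases hva : v = a
        · subst hva
          rw [Function.update_self, if_pos (mem_insert_self _ _), hz _ _ _ fun τ hτ => (hon τ hτ).symm]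
        · rw [Function.update_of_ne hva]
          by_cases hvQ : v ∈ Q
          · rw [if_pos hvQ, if_pos (mem_insert_of_mem hvQ)]
            refine hz v _ _ fun τ hτ => (hoff τ ?_).symm
            rintro rfl; exact hva hτ.symm
          · rw [if_neg hvQ, Function.update_of_ne hva, if_neg]
            rw [mem_insert, not_or]; exact ⟨hva, hvQ⟩
      rw [hupd, prod_insert haQ, hKQ, hKa, smul_smul, mul_comm]
  have h := key univ (fun _ => 1)
  simp only [mem_univ, if_true] at h
  rw [h]
  refine sum_congr ?_ fun x _ => rfl
  ext x
  simp

end Block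

/-! ### Kernel-weighted cluster monomials: the expansion into tree sums -/

section Clusters

open Literature.Probability.LatticeModels.BattleFederbush

variable (R : Type*) [CommRing R] {n : Type*} [LinearOrder n]
variable {ι : Type*} [DecidableEq ι] {F : Type*} [Fintype F] [LinearOrder F]

omit [LinearOrder F] in
/-- The cluster monomial of `x` only reads the labels of the field pairs of `x`. [folklore] -/
theorem FermionicTree.evenCluster_congr (c : F → ι) {i j i' j' : F → n} (x : ι)
    (hi : ∀ f, c f = x → i f = i' f) (hj : ∀ f, c f = x → j f = j' f) :
    FermionicTree.evenCluster R c i j x = FermionicTree.evenCluster R c i' j' x := by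
  refine Subtype.ext ?_
  simp only [FermionicTree.coe_evenCluster, FermionicTree.clusterMonomial]
  refine Finset.noncommProd_congr rfl (fun f hf => ?_) _
  have hfx : c f = x := by simpa [FermionicTree.mem_fieldsOf] using hf
  rw [FermionicTree.pairOp, FermionicTree.pairOp, hi f hfx, hj f hfx]

variable [Fintype n] [Algebra ℚ R] {J : Type*} [LinearOrder J] [Fintype J]
variable {S : Type*} [Fintype S] [DecidableEq S] {Λ : Type*} [AddCommGroup Λ] [Fintype Λ] [DecidableEq Λ]

/-- **Truncated expectation of kernel-weighted cluster monomials = kernel-weighted sum of tree sums**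
(Benfatto–Giuliani–Mastropietro 2006, (2.31) with (2.66)): the fields of the pair `f` (cluster `c f`) sit
in the slots `sb f` (the `ψ̄`) and `su f` (the `ψ`) of its cluster, at positions `x(sb f)`, `x(su f) ∈ Λ`
labelled by `lab : Λ → n`; the cluster `w` carries `Σ_x K w x • ψ̃_x(P_w)` with
`ψ̃_x(P_w) = ∏_{f : c f = w} ψ̄_{lab x(sb f)} ψ_{lab x(su f)}` and a scalar kernel `K w` reading the slots of
`w` only.  Then, for the normalised Gaussian integration of the block (`u ε det A = 1`) and every root `v`,
`𝓔ᵀ(Σ_x K w x • ψ̃_x(P_w) : w) = (Σ_{x : S → Λ} (∏_w K w x) · treeSum_x) · 1` with the tree sum of the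
propagator `G_x f f' = (A⁻¹)_{lab x(su f), lab x(sb f')}`.
[cite: BenfattoGiulianiMastropietro2006, (2.31) (2.66)] -/
theorem FermionicTree.evenTruncated_kernelClusters_eq_algebraMap_sum [Fintype ι] (e : n ⊕ₗ n ↪o J)
    (A : Matrix n n R) (hA : IsUnit A.det) (u : R)
    (hu : u * ((-1 : R) ^ (Fintype.card n * (Fintype.card n - 1) / 2) * A.det) = 1)
    (c : F → ι) (cS : S → ι) (lab : Λ → n) (sb su : F → S) (hsb : ∀ f, cS (sb f) = c f)
    (hsu : ∀ f, cS (su f) = c f) (K : ι → (S → Λ) → R)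
    (hK : ∀ w x x', (∀ τ, cS τ = w → x τ = x' τ) → K w x = K w x') {v : ι} :
    evenTruncated R e A u (fun w => ∑ x ∈ univ.filter (fun x : S → Λ => ∀ τ, cS τ ≠ w → x τ = 0),
        K w x • evenMap R e
          (FermionicTree.evenCluster R c (fun f => lab (x (sb f))) (fun f => lab (x (su f))) w)) univ =
      algebraMap R (evenPart R J) (∑ x : S → Λ, (∏ w, K w x) *
        FermionicTree.treeSum c (Matrix.of fun f f' => A⁻¹ (lab (x (su f))) (lab (x (sb f')))) v univ) := by
  classical
  rw [evenTruncated_kernelVertices_eq_sum R e A u cS K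
    (fun w x => evenMap R e
      (FermionicTree.evenCluster R c (fun f => lab (x (sb f))) (fun f => lab (x (su f))) w)) hK
    (fun w x x' hxx' => by
      rw [FermionicTree.evenCluster_congr R c w (i' := fun f => lab (x' (sb f))) (j' := fun f => lab (x' (su f)))
        (fun f hf => by simp only [hxx' (sb f) ((hsb f).trans hf)])
        (fun f hf => by simp only [hxx' (su f) ((hsu f).trans hf)])]),
    map_sum]
  refine sum_congr rfl fun x _ => ?_
  rw [FermionicTree.evenTruncated_evenCluster_eq_treeSum R e A hA u hu c _ _ univ (mem_univ v), map_mul,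
    Algebra.smul_def]

end Clusters

end Literature.MathematicalPhysics.QuantumLattice
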